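/-
Copyright: the b2b-balaban T⁴-continuum CRUX team, row NE7b OWNER lineage `t4-ne7b-p1` (gen 146). Project licence.
-/
import Summits.QuantumFields.BalabanUV.T4Continuum.Spine.NE7b.SupWeightedFivePointTools

/-!
# SCALAR TOOLS FOR THE WEIGHTED FIVE-POINT SLOT LETTERS, II (SCOPING-d17 §F, F13–F17).  The slot files sum each term of `M₅′` ((687))
# against the routed full-graph weight; the per-level bounds compare the routed loads (`ϑ^n` with `n ≤ 6` on `ρ`-edges, `≤ 4` on Hessian and
# internal edges, `≤ 2` on `r₁`-star edges) with the class's uniform geometry letters (`G = sup Σ ϑ⁶∕√ρ`, `Θ8 = sup Σ ϑ⁸∕ϑ₂`,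
# `S2 = sup Σ ϑ²∕r₁`), split the interpolated radicands (`√(cXsC) = √X·√(csC)`), absorb the non-star pairs of the product-decay terms
# (`ϑ·r₁⁻¹ ≤ 1`), and sum the `U‴`-triple by the two-index Cauchy–Schwarz in the letters' `K3·(ϑ₂ϑ₂ϑ₂)` order
# (row NE7b, node U5c; Mathlib ∕ (649) ∕ (689) only; [folklore]).

Cell `pub-balaban`, sub-cell `t4`, spine estimate NE7b (`T4WeightBudget.RelWeightBound`; the cell's OWN estimate — NOT PRINTED in
[Bałaban 1983–89], NOT PROVED).  Crux-route work under `Spine/NE7b/` by the row OWNER (`t4-ne7b-p1` gen 146, file (691)) under FREEZE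
(0)'s crux-prover clause; NOTHING of Bałaban's is named as a Lean object, valued or asserted; no `T4Continuum/Support` leaf typed; no
`def`, no notation; zero `sorry`.  Imports (BY NAME): the OWNER's (689) `…SupWeightedFivePointTools` ((649) through it).

WHAT IS PROVED ([folklore]): `rmono`, `smono`, `tmono`, `pmono`, `geom2`, `sum2_sqrt_mul_le_letters'`, `absorb_le_one`, `mul_le_one_of`,
`sqrt_split3`, `sqrt_split4`, `sqrt_split_tree`; toy.

HONEST (what this is NOT).  Abstract inequalities only; the five weighted slot letters of `M₅′` are the next files; scalar skeleton ((A3),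
NC-NE7b-α UNRULED); nothing of Bałaban's asserted.  BY-NAME EFFECT ON THE WALL: NONE.  NE7b NOT PRINTED ∕ NOT PROVED; spine PROVED 0∕9; rung
(B)+1 — the programme's measures remain FINITE-torus statements; NOT the mass gap, NOT Clay.  HONEST DEPENDENCY: continuum YM on T⁴ ⇐ BetaPertH
∧ nine spine estimates (0∕9 proved); BetaPertH ⇐ (D1) ∧ (D4) ∧ CAP+tail; G-an2-4 gates asym, D1 and NE2∕3∕4.
-/

set_option autoImplicit false

noncomputable section

namespace Summit.QuantumFields.BalabanUV.T4Continuum.NE7b.SupWeightedFivePointToolsTwo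

open Finset Real
open scoped BigOperators
open SupWeightedFivePointTools (sum2_sqrt_mul_le_letters)

/-! ## §1. Load monotonicity against the uniform letters -/

/-- `ρ`-edge: `ϑⁿ∕√ρ ≤ ϑ⁶∕√ρ` for `n ≤ 6`, `ϑ ≥ 1`. [folklore] -/
theorem rmono {ϑ ρ : ℝ} {n : ℕ} (h1 : 1 ≤ ϑ) (hρ : 0 < ρ) (hn : n ≤ 6) : ϑ ^ n / Real.sqrt ρ ≤ ϑ ^ 6 / Real.sqrt ρ :=
  div_le_div_of_nonneg_right (pow_le_pow_right₀ h1 hn) (Real.sqrt_pos.2 hρ).le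

/-- `r₁`-star edge: `ϑⁿ·r⁻¹ ≤ ϑ²∕r` for `n ≤ 2`, `ϑ ≥ 1`. [folklore] -/
theorem smono {ϑ r : ℝ} {n : ℕ} (h1 : 1 ≤ ϑ) (hr : 0 < r) (hn : n ≤ 2) : ϑ ^ n * r⁻¹ ≤ ϑ ^ 2 / r := by
  rw [div_eq_mul_inv]
  exact mul_le_mul_of_nonneg_right (pow_le_pow_right₀ h1 hn) (inv_nonneg.2 hr.le)

/-- Hessian edge (Cauchy–Schwarz side): `(ϑⁿ)²∕θ ≤ (ϑ⁴)²∕θ` for `n ≤ 4`. [folklore] -/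
theorem tmono {ϑ θ : ℝ} {n : ℕ} (h1 : 1 ≤ ϑ) (hθ : 0 < θ) (hn : n ≤ 4) : (ϑ ^ n) ^ 2 / θ ≤ (ϑ ^ 4) ^ 2 / θ :=
  div_le_div_of_nonneg_right (pow_le_pow_left₀ (pow_nonneg (zero_le_one.trans h1) _) (pow_le_pow_right₀ h1 hn) 2) hθ.le

/-- The `U‴`-triple's geometry (Cauchy–Schwarz side): `(ϑ_a^i ϑ_b^j ϑ_c^k)²∕(θ₁θ₂θ₃) ≤ (ϑ_a⁴)²∕θ₁ · (ϑ_b⁴)²∕θ₂` when `(ϑ_c^k)² ≤ θ₃`,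
`i, j ≤ 4`. [folklore] -/
theorem pmono {a b c θ₁ θ₂ θ₃ : ℝ} {i j k : ℕ} (ha : 1 ≤ a) (hb : 1 ≤ b) (hc : 1 ≤ c) (h₁ : 0 < θ₁) (h₂ : 0 < θ₂) (h₃ : 0 < θ₃)
    (hck : (c ^ k) ^ 2 ≤ θ₃) (hi : i ≤ 4) (hj : j ≤ 4) :
    (a ^ i * b ^ j * c ^ k) ^ 2 / (θ₁ * θ₂ * θ₃) ≤ (a ^ 4) ^ 2 / θ₁ * ((b ^ 4) ^ 2 / θ₂) := by
  have ha0 : 0 ≤ a := zero_le_one.trans ha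
  have hb0 : 0 ≤ b := zero_le_one.trans hb
  have hq : (c ^ k) ^ 2 / θ₃ ≤ 1 := (div_le_one h₃).2 hck
  calc (a ^ i * b ^ j * c ^ k) ^ 2 / (θ₁ * θ₂ * θ₃) = (a ^ i) ^ 2 / θ₁ * ((b ^ j) ^ 2 / θ₂) * ((c ^ k) ^ 2 / θ₃) := by
        rw [mul_pow, mul_pow]; field_simp
    _ ≤ (a ^ 4) ^ 2 / θ₁ * ((b ^ 4) ^ 2 / θ₂) * 1 :=
        mul_le_mul (mul_le_mul (tmono ha h₁ hi) (tmono hb h₂ hj) (by positivity) (by positivity)) hq (by positivity) (by positivity)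
    _ = (a ^ 4) ^ 2 / θ₁ * ((b ^ 4) ^ 2 / θ₂) := mul_one _

/-! ## §2. Double sums -/

variable {ι : Type} [Fintype ι]

/-- A product of two single-index letters bounds the double sum of the product. [folklore] -/
theorem geom2 {f g : ι → ℝ} {T T' : ℝ} (hg : ∀ c, 0 ≤ g c) (hF : ∑ b, f b ≤ T) (hG : ∑ c, g c ≤ T') (hT : 0 ≤ T) :
    ∑ b, ∑ c, f b * g c ≤ T * T' := by
  calc ∑ b, ∑ c, f b * g c = (∑ b, f b) * (∑ c, g c) := by rw [sum_mul_sum]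
    _ ≤ T * T' := mul_le_mul hF hG (sum_nonneg fun c _ => hg c) hT

/-- **TWO-INDEX WEIGHTED CAUCHY–SCHWARZ in the letters' order** (`a·θ`): `Σ_bΣ_c √(a_{bc})·c_{bc} ≤ √(A·S)`. [folklore] -/
theorem sum2_sqrt_mul_le_letters' {a c θ : ι → ι → ℝ} {Aθ Sθ : ℝ} (ha : ∀ b c', 0 ≤ a b c') (hc : ∀ b c', 0 ≤ c b c')
    (hθ : ∀ b c', 0 < θ b c') (hA : ∑ b, ∑ c', a b c' * θ b c' ≤ Aθ) (hS : ∑ b, ∑ c', c b c' ^ 2 / θ b c' ≤ Sθ) :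
    ∑ b, ∑ c', Real.sqrt (a b c') * c b c' ≤ Real.sqrt (Aθ * Sθ) :=
  sum2_sqrt_mul_le_letters ha hc hθ (by simpa only [mul_comm] using hA) hS

/-! ## §3. Absorption and splitting -/

/-- A non-star pair of a product-decay term is absorbed: `ϑ ≤ r`, `r > 0` give `ϑ·r⁻¹ ≤ 1`. [folklore] -/
theorem absorb_le_one {ϑ r : ℝ} (h : ϑ ≤ r) (hr : 0 < r) : ϑ * r⁻¹ ≤ 1 := by
  rw [← div_eq_mul_inv, div_le_one hr]; exact h

/-- `a ≤ 1`, `0 ≤ b ≤ 1 ⟹ ab ≤ 1`. [folklore] -/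
theorem mul_le_one_of {a b : ℝ} (ha : a ≤ 1) (hb0 : 0 ≤ b) (hb : b ≤ 1) : a * b ≤ 1 := by nlinarith

/-- Radicand split, one vertex factor: `√(c·X·s·C) = √X·√(c·s·C)` (`X ≥ 0`). [folklore] -/
theorem sqrt_split3 {X : ℝ} (hX : 0 ≤ X) (c s C : ℝ) : Real.sqrt (c * X * s * C) = Real.sqrt X * Real.sqrt (c * s * C) := by
  rw [← Real.sqrt_mul hX]; congr 1; ring

/-- Radicand split, two vertex factors: `√(c·X·Y·s·C) = √X·√Y·√(c·s·C)` (`X, Y ≥ 0`). [folklore] -/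
theorem sqrt_split4 {X Y : ℝ} (hX : 0 ≤ X) (hY : 0 ≤ Y) (c s C : ℝ) :
    Real.sqrt (c * X * Y * s * C) = Real.sqrt X * Real.sqrt Y * Real.sqrt (c * s * C) := by
  rw [← Real.sqrt_mul hX, ← Real.sqrt_mul (mul_nonneg hX hY)]; congr 1; ring

/-- Radicand split, tree form: `√(16·(8·X·S·C)) = √X·√(16·(8·S·C))` (`X ≥ 0`). [folklore] -/
theorem sqrt_split_tree {X : ℝ} (hX : 0 ≤ X) (S C : ℝ) : Real.sqrt (16 * (8 * X * S * C)) = Real.sqrt X * Real.sqrt (16 * (8 * S * C)) := by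
  rw [← Real.sqrt_mul hX]; congr 1; ring

/-! ## §4. Toy -/

/-- Toy (absorption in numbers): `ϑ = 2 ≤ r = 4`: `2·4⁻¹ ≤ 1`. -/
example : (2 : ℝ) * (4 : ℝ)⁻¹ ≤ 1 := by norm_num

end Summit.QuantumFields.BalabanUV.T4Continuum.NE7b.SupWeightedFivePointToolsTwo

end
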